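import Summits.ValiantsHypothesis.ValiantsHypothesis.Theorems.KPlusLogSqLawWeakLiftingTowerGraftGraftFloorLemma
import Summits.ValiantsHypothesis.ValiantsHypothesis.Theorems.LacunarySymmetroidMatrixDescartesCensusDefs

/-!
# Tower graft line — the CORNER GRAFT FLOOR AT EVERY SIZE `m + 1`:
# `det (G₀ + s·X^D·e₀e₀ᵀ) = det G₀ + s·X^D·det (G₀)₀₀-minor`, so one far rank-one letter buys `W + 1` roots,
# `W` = alternations of the principal-MINOR pencil right of the cut

All-size companion of `…TowerGraftGraftFloorPencil` (which treats `m + 1 = 2`, where the minor is the other diagonal entry).  For a real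
symmetric `(m+1) × (m+1)` pencil `G₀ = ∑ X^{d l} S l` on `d` and the rank-one far letter `X^D · s · e₀e₀ᵀ` (`Matrix.single 0 0 s`):

* `pencil_snoc_single` — the grafted pencil is `G₀ + single 0 0 (C s · X^D)`;
* `det_add_single` — `det (G + single 0 0 a) = det G + a · det (G.submatrix succ succ)` (row-linearity + the adjugate entry);
* `submatrix_pencil` — the principal minor of a pencil is the pencil of the principal minors (same support `d`, size `m`);
* ★ `corner_graft_floor_succ` — if `det G₀` alternates (non-zero) on `Z + 1` points left of a cut `ρ` and the MINOR PENCIL's determinant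
  alternates on `W + 1` points right of it (junction sign `σ`), then `∃ D₀ ∀ D ≥ D₀ : ¬ PosRootLawOn (m+1) (K+1) (Z + W) (Fin.snoc d D)` —
  one far rank-one letter buys `W + 1` roots at ANY size, where `W` can be as large as the size-`m` class budget of `d` allows
  (the tree's all-format GRAFT LAW `Census.Graft.exists_alternating_succ` buys `m + 1` at the last test point; the cut trades the
  det-alternations right of `ρ` for the minor's).

This is the floor-side dual of the line's corner-graft CAP law S4b (`stub_graftLawCorner`: `det G + t^D·det G_{ii} ≤ 2^C·B + 2^{C log₂² m}`
roots, with BOTH determinants carrying class budgets): the additive term must pay for the minor's alternations beyond the cut.  The cell's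
located `(3,4)` / `(4,4)` «CAP + FLAG» tower rows are instances of this mechanism.  No ε-completion is typed at general size (the
`2 × 2`-removed minor may vanish).  HONEST FRAMING: elementary; NO stub of the line is claimed; nothing on `WeakLifting`, Conjecture B,
`MatrixDescartes` (18050) or `VP ≠ VNP`.  Def-free.  Seat: prover leafhand-val-kpluslogsqlaw-1 g4, `--supports stmt-ValiantsHypothesis-19561`.
[folklore] row-linearity of `det`, `Matrix.adjugate_fin_succ_eq_det_submatrix`.
-/

-- `Summit.ValiantsHypothesis.ValiantsHypothesis.…` repeats a component by the D-0017 layout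
-- (single-conjunct summit), which the `dupNamespace` linter flags; the name is mandated.
set_option linter.dupNamespace false
set_option autoImplicit false

namespace Summit.ValiantsHypothesis.ValiantsHypothesis.Theorems.KPlusLogSqLaw.TowerGraft

open Polynomial Finset
open scoped BigOperators
open Summit.ValiantsHypothesis.ValiantsHypothesis.Theorems.LacunarySymmetroidMatrixDescartes (PosRootLawOn)

namespace GraftFloor

variable {K m : ℕ}

/-- the grafted pencil with the rank-one far letter `single 0 0 s` at exponent `D` is `G₀ + single 0 0 (C s · X^D)`. [folklore] -/
theorem pencil_snoc_single (d : Fin K → ℕ) (S : Fin K → Matrix (Fin (m + 1)) (Fin (m + 1)) ℝ) (D : ℕ) (s : ℝ) :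
    (∑ l, (X : ℝ[X]) ^ (Fin.snoc d D : Fin (K + 1) → ℕ) l •
        ((Fin.snoc S (Matrix.single 0 0 s) : Fin (K + 1) → Matrix (Fin (m + 1)) (Fin (m + 1)) ℝ) l).map C) =
      (∑ l, (X : ℝ[X]) ^ d l • (S l).map C) + Matrix.single 0 0 (C s * X ^ D) := by
  rw [Fin.sum_univ_castSucc]
  simp only [Fin.snoc_castSucc, Fin.snoc_last]
  rw [Matrix.map_single (0 : Fin (m + 1)) (0 : Fin (m + 1)) s C, Matrix.smul_single, smul_eq_mul, mul_comm]

/-- **corner update of a determinant**: `det (G + single 0 0 a) = det G + a · det (G.submatrix succ succ)`. [folklore] -/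
theorem det_add_single (G : Matrix (Fin (m + 1)) (Fin (m + 1)) ℝ[X]) (a : ℝ[X]) :
    (G + Matrix.single 0 0 a).det = G.det + a * (G.submatrix Fin.succ Fin.succ).det := by
  have h1 : G + Matrix.single 0 0 a = G.updateRow 0 (G 0 + a • Pi.single 0 1) := by
    ext i j
    by_cases hi : i = 0
    · subst hi
      by_cases hj : j = 0
      · subst hj; simp
      · simp [hj, Matrix.single_apply_of_col_ne _ _ (Ne.symm hj)]
    · simp [hi, Matrix.single_apply_of_row_ne (Ne.symm hi)]
  rw [h1, Matrix.det_updateRow_add, Matrix.updateRow_eq_self, Matrix.det_updateRow_smul, ← Matrix.adjugate_apply,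
    Matrix.adjugate_fin_succ_eq_det_submatrix]
  simp

/-- the principal minor of a pencil is the pencil of the principal minors. [folklore] -/
theorem submatrix_pencil (d : Fin K → ℕ) (S : Fin K → Matrix (Fin (m + 1)) (Fin (m + 1)) ℝ) :
    (∑ l, (X : ℝ[X]) ^ d l • (S l).map C).submatrix Fin.succ Fin.succ =
      ∑ l, (X : ℝ[X]) ^ d l • ((S l).submatrix Fin.succ Fin.succ).map C := by
  ext i j
  simp [Matrix.sum_apply]

/-- the rank-one far letter is symmetric, so the grafted letters are. [folklore] -/
theorem isSymm_snoc_single (S : Fin K → Matrix (Fin (m + 1)) (Fin (m + 1)) ℝ) (hS : ∀ l, (S l).IsSymm) (s : ℝ) :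
    ∀ l, ((Fin.snoc S (Matrix.single 0 0 s) : Fin (K + 1) → Matrix (Fin (m + 1)) (Fin (m + 1)) ℝ) l).IsSymm := by
  intro l
  induction l using Fin.lastCases with
  | last =>
    rw [Fin.snoc_last]
    unfold Matrix.IsSymm
    rw [Matrix.transpose_single]
  | cast i =>
    rw [Fin.snoc_castSucc]
    exact hS i

/-- ★ **CORNER GRAFT FLOOR AT EVERY SIZE.**  Let `G₀ = ∑ X^{d l} S l` be a real symmetric `(m+1) × (m+1)` pencil (`K` letters) whose
determinant alternates (non-zero) on `0 < τ₀ < ⋯ < τ_Z < ρ`, and whose principal-minor pencil `∑ X^{d l} (S l)₀₀-minor` has determinant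
alternating (non-zero) on `ρ < τ'₀ < ⋯ < τ'_W`, with junction sign `σ ∈ {1, −1}`.  Then for all far exponents `D ≥ D₀` the support
`Fin.snoc d D` carries a symmetric pencil (rank-one top letter) with `≥ Z + W + 1` positive determinant roots:
`¬ PosRootLawOn (m+1) (K+1) (Z + W) (Fin.snoc d D)`. [this work] -/
theorem corner_graft_floor_succ {Z W : ℕ} (d : Fin K → ℕ) (S : Fin K → Matrix (Fin (m + 1)) (Fin (m + 1)) ℝ)
    (hS : ∀ l, (S l).IsSymm) (τ : Fin (Z + 1) → ℝ) (τ' : Fin (W + 1) → ℝ) (ρ σ : ℝ)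
    (hτm : StrictMono τ) (hτ'm : StrictMono τ') (hτ0 : 0 < τ 0) (hτρ : τ (Fin.last Z) < ρ) (hρτ' : ρ < τ' 0)
    (hp0 : ∀ i, (∑ l, (X : ℝ[X]) ^ d l • (S l).map C).det.eval (τ i) ≠ 0)
    (hq0 : ∀ j, (∑ l, (X : ℝ[X]) ^ d l • ((S l).submatrix Fin.succ Fin.succ).map C).det.eval (τ' j) ≠ 0)
    (hp : ∀ i : Fin Z, (∑ l, (X : ℝ[X]) ^ d l • (S l).map C).det.eval (τ i.castSucc) *
      (∑ l, (X : ℝ[X]) ^ d l • (S l).map C).det.eval (τ i.succ) < 0)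
    (hq : ∀ j : Fin W, (∑ l, (X : ℝ[X]) ^ d l • ((S l).submatrix Fin.succ Fin.succ).map C).det.eval (τ' j.castSucc) *
      (∑ l, (X : ℝ[X]) ^ d l • ((S l).submatrix Fin.succ Fin.succ).map C).det.eval (τ' j.succ) < 0)
    (hσ : σ = 1 ∨ σ = -1)
    (hjunc : (∑ l, (X : ℝ[X]) ^ d l • (S l).map C).det.eval (τ (Fin.last Z)) *
      (σ * (∑ l, (X : ℝ[X]) ^ d l • ((S l).submatrix Fin.succ Fin.succ).map C).det.eval (τ' 0)) < 0) :
    ∃ D₀ : ℕ, ∀ D : ℕ, D₀ ≤ D → ¬ PosRootLawOn (m + 1) (K + 1) (Z + W) (Fin.snoc d D : Fin (K + 1) → ℕ) := by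
  obtain ⟨D₀, hD₀⟩ := le_card_posRoots_graft _ _ τ τ' ρ σ hτm hτ'm hτ0 hτρ hρτ' hp0 hq0 hp hq hσ hjunc
  refine ⟨D₀, fun D hD hlaw => ?_⟩
  have hcount := hD₀ D hD
  have hle := hlaw _ (isSymm_snoc_single S hS (σ * (ρ⁻¹) ^ D))
  rw [pencil_snoc_single, det_add_single, submatrix_pencil] at hle
  omega

end GraftFloor

end Summit.ValiantsHypothesis.ValiantsHypothesis.Theorems.KPlusLogSqLaw.TowerGraft
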